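import Literature.Algebra.Homology.OrderedCechSystemMap
import Mathlib.Algebra.Homology.HomologicalBicomplex
import Mathlib.Algebra.Category.ModuleCat.Monoidal.Basic
import HarnessLib

/-!
# Pair-systems of modules and their ordered Čech bicomplex (Stacks 0BEC, 012K) — leaves

Layer `Literature/Algebra/Homology` (constructions + proved lemmas; 0 named facts, no instance, no notation; pure
homological algebra over a commutative ring `A`, no geometry). For two finite linearly ordered index sets `ι`, `κ`, a
PAIR-SYSTEM of `A`-modules is a functor `P : Finset ι ⥤ Finset κ ⥤ ModuleCat A` (`(s, t) ↦ P s t` with restriction maps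
in both variables — the shape of `(s, t) ↦ Γ(U_s ×_S V_t, 𝓕)` for a sheaf on a product and two affine covers; The Stacks
Project, Tag 0BEC, proof of the Künneth formula, works with exactly this double complex). Its ORDERED ČECH BICOMPLEX `Č•,•(P)`
has `Čᵃ,ᵇ(P) = Π_{τ ∈ Simplex κ b} Π_{σ ∈ Simplex ι a} P σ τ`, horizontal differential the ordered Čech differential in `σ`
(`OrderedCech.sysD` of `Algebra/Homology/OrderedCechSystem`, Görtz–Wedhorn II Def. 21.68) and vertical differential the one
in `τ`; it is a `HomologicalComplex₂` in Mathlib's sense (a complex of complexes: outer index `a`, inner index `b`, COMMUTING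
differentials — the Koszul signs enter only in `HomologicalComplex₂.total`, Stacks 012K).

* `sysCochainFunctor`, `sysComplexFunctor` — `M ↦ Čⁿ(M)`, `M ↦ Č•(M)` as functors in the system (packaging
  `OrderedCechSystemMap.sysCochainMap` / `sysComplexMap`);
* `cochainSystem P a : Finset κ ⥤ ModuleCat A`, `t ↦ Π_σ P σ t`; `cochainSystemD P a` — the `σ`-differential as a morphism
  of `κ`-systems (naturality = `sysD_sysCochainMap`), `cochainSystemD_comp` (`sysD_sysD`);
* **`sysBicomplex P : HomologicalComplex₂ (ModuleCat A) (up ℤ) (up ℤ)`** — outer term `a ↦ Č•(cochainSystem P a)`, outer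
  differential `sysComplexMap (cochainSystemD P a)`; element formulas `sysBicomplex_X_d_apply`, `sysBicomplex_d_f_apply`;
* `prodSystem M N = (s, t) ↦ M s ⊗_A N t` for two systems `M`, `N` (Mathlib `curriedTensor` of `ModuleCat A`).

The comparison `Č•(M) ⊗ Č•(N) ≅ Tot Č•,•(M ⊠ N)` is the sequel `Algebra/Homology/OrderedCechSystemBicomplex`. Library only
(cell `pub-hodge-ring2`, count-neutral); proves nothing about any crux, route or conjecture. Mathlib searched (pin v4.32):
`HomologicalComplex₂`, `CochainComplex.of` / `of_d`, `Functor.flip`, `Functor.whiskeringLeft`, `MonoidalCategory.curriedTensor` (used).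

## References

* The Stacks Project, Tag 0BEC (Künneth formula: the double Čech complex of the product covering), Tag 012K (double
  complexes, associated total complex), Tag 01FG (ordered Čech complex). [StacksProject]
* U. Görtz, T. Wedhorn, *Algebraic Geometry II* (2023), Def. 21.64, Def. 21.68 (pp. 179–180). [GortzWedhorn2023]
-/

universe u

open CategoryTheory MonoidalCategory

set_option backward.isDefEq.respectTransparency false

noncomputable section

namespace Literature.Algebra.Homology

namespace OrderedCech

variable {A : Type u} [CommRing A] {ι κ : Type} [LinearOrder ι] [LinearOrder κ]

/-! ### §1 `M ↦ Čⁿ(M)` and `M ↦ Č•(M)` as functors in the system -/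

variable (ι A) in
/-- **`M ↦ Čⁿ(M)`** as a functor from systems of `A`-modules on `Finset ι` to `A`-modules (componentwise maps,
`OrderedCechSystemMap.sysCochainMap`). [cite: GortzWedhorn2023, Def. 21.68 (p. 180)] -/
def sysCochainFunctor (n : ℤ) : (Finset ι ⥤ ModuleCat.{u} A) ⥤ ModuleCat.{u} A where
  obj M := ModuleCat.of A (SysCochain M n)
  map φ := ModuleCat.ofHom (sysCochainMap φ n)
  map_id _ := by ext g; rfl
  map_comp _ _ := by ext g; rfl

variable (ι A) in
/-- **`M ↦ Č•(M)`** as a functor from systems to cochain complexes (`sysComplexMap`, `sysComplexMap_id`,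
`sysComplexMap_comp`). [cite: GortzWedhorn2023, Def. 21.68 (p. 180)] -/
def sysComplexFunctor : (Finset ι ⥤ ModuleCat.{u} A) ⥤ CochainComplex (ModuleCat.{u} A) ℤ where
  obj M := sysComplex M
  map φ := sysComplexMap φ
  map_id _ := sysComplexMap_id
  map_comp φ ψ := sysComplexMap_comp φ ψ

/-! ### §2 The ordered Čech bicomplex of a pair-system -/

section PairSystem

variable (P : Finset ι ⥤ Finset κ ⥤ ModuleCat.{u} A)

/-- **The `κ`-system of `σ`-cochains** `t ↦ Čᵃ(P(·, t)) = Π_{σ ∈ Simplex ι a} P σ t` of a pair-system, with the restriction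
maps of `P` in the second variable. [cite: StacksProject, Tag 0BEC] -/
def cochainSystem (a : ℤ) : Finset κ ⥤ ModuleCat.{u} A :=
  P.flip ⋙ sysCochainFunctor A ι a

omit [LinearOrder κ] in
/-- The objects of `cochainSystem` (`rfl`). [cite: StacksProject, Tag 0BEC] -/
@[simp] theorem cochainSystem_obj (a : ℤ) (t : Finset κ) :
    (cochainSystem P a).obj t = ModuleCat.of A (SysCochain (P.flip.obj t) a) := rfl

omit [LinearOrder κ] in
/-- The maps of `cochainSystem` are the componentwise restrictions in `t` (`rfl`). [cite: StacksProject, Tag 0BEC] -/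
theorem cochainSystem_map_apply (a : ℤ) {t t' : Finset κ} (h : t ⟶ t') (g : SysCochain (P.flip.obj t) a) :
    ((cochainSystem P a).map h).hom g = sysCochainMap (P.flip.map h) a g := rfl

/-- **The `σ`-Čech differential `Čᵃ(P(·, t)) → Čᵃ⁺¹(P(·, t))` as a morphism of `κ`-systems** (natural in `t` because the
Čech differential commutes with maps of systems, `sysD_sysCochainMap`). [cite: GortzWedhorn2023, Def. 21.68 (p. 180)]
[cite: StacksProject, Tag 0BEC] -/
def cochainSystemD (a : ℤ) : cochainSystem P a ⟶ cochainSystem P (a + 1) where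
  app t := ModuleCat.ofHom (sysD (P.flip.obj t) a)
  naturality t t' h := by
    ext g
    exact sysD_sysCochainMap (P.flip.map h) g

omit [LinearOrder κ] in
/-- The components of `cochainSystemD` (`rfl`). [cite: GortzWedhorn2023, Def. 21.68 (p. 180)] -/
@[simp] theorem cochainSystemD_app_apply (a : ℤ) (t : Finset κ) (g : SysCochain (P.flip.obj t) a) :
    ((cochainSystemD P a).app t).hom g = sysD (P.flip.obj t) a g := rfl

omit [LinearOrder κ] in
/-- `δ ≫ δ = 0` for the `σ`-differentials of systems (`sysD_sysD`). [cite: GortzWedhorn2023, Def. 21.68 (p. 180)] -/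
theorem cochainSystemD_comp (a : ℤ) : cochainSystemD P a ≫ cochainSystemD P (a + 1) = 0 := by
  ext t g
  exact sysD_sysD (P.flip.obj t) a g

/-- **The ordered Čech bicomplex `Č•,•(P)` of a pair-system**: outer index the `σ`-degree `a`, inner index the `τ`-degree
`b`, `Čᵃ,ᵇ(P) = Π_τ Π_σ P σ τ`; the `a`-th column is the ordered Čech complex of the `κ`-system `cochainSystem P a`, the
outer differential is `sysComplexMap` of the `σ`-differential `cochainSystemD P a`. [cite: StacksProject, Tag 0BEC]
[cite: StacksProject, Tag 012K] -/
def sysBicomplex : HomologicalComplex₂ (ModuleCat.{u} A) (ComplexShape.up ℤ) (ComplexShape.up ℤ) :=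
  CochainComplex.of (fun a => sysComplex (cochainSystem P a)) (fun a => sysComplexMap (cochainSystemD P a))
    fun a => by
      rw [← sysComplexMap_comp, cochainSystemD_comp]
      ext n g
      rfl

/-- The columns of `Č•,•(P)` (`rfl`). [cite: StacksProject, Tag 0BEC] -/
@[simp] theorem sysBicomplex_X (a : ℤ) : (sysBicomplex P).X a = sysComplex (cochainSystem P a) := rfl

/-- The outer differential of `Č•,•(P)` is `sysComplexMap` of the `σ`-differential. [cite: StacksProject, Tag 0BEC] -/
theorem sysBicomplex_d (a : ℤ) : (sysBicomplex P).d a (a + 1) = sysComplexMap (cochainSystemD P a) := by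
  change CochainComplex.of.d (V := CochainComplex (ModuleCat.{u} A) ℤ) (fun a => sysComplex (cochainSystem P a))
    (fun a => sysComplexMap (cochainSystemD P a)) a (a + 1) = _
  exact CochainComplex.of_d _ _ a

/-- The terms `Čᵃ,ᵇ(P) = Π_{τ ∈ Simplex κ b} Π_{σ ∈ Simplex ι a} P σ τ` (`rfl`). [cite: StacksProject, Tag 0BEC] -/
theorem sysBicomplex_X_X (a b : ℤ) :
    ((sysBicomplex P).X a).X b = ModuleCat.of A (SysCochain (cochainSystem P a) b) := rfl

/-- The inner (`τ`-) differential of `Č•,•(P)` on elements: the ordered Čech differential of `cochainSystem P a`.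
[cite: StacksProject, Tag 0BEC] -/
theorem sysBicomplex_X_d_apply (a b : ℤ) (x : SysCochain (cochainSystem P a) b) :
    (((sysBicomplex P).X a).d b (b + 1)).hom x = sysD (cochainSystem P a) b x := by
  change ((sysComplex (cochainSystem P a)).d b (b + 1)).hom x = _
  rw [sysComplex_d]
  rfl

/-- The outer (`σ`-) differential of `Č•,•(P)` on elements: componentwise in `τ` the `σ`-differential.
[cite: StacksProject, Tag 0BEC] -/
theorem sysBicomplex_d_f_apply (a b : ℤ) (x : SysCochain (cochainSystem P a) b) :
    (((sysBicomplex P).d a (a + 1)).f b).hom x = sysCochainMap (cochainSystemD P a) b x := by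
  rw [sysBicomplex_d, sysComplexMap_f]
  rfl

end PairSystem

/-! ### §3 Product systems `(s, t) ↦ M s ⊗ N t` -/

section Tensor

variable (M : Finset ι ⥤ ModuleCat.{u} A) (N : Finset κ ⥤ ModuleCat.{u} A)

omit [LinearOrder ι] [LinearOrder κ] in
/-- **The product pair-system `(s, t) ↦ M s ⊗_A N t`** of two systems. [cite: StacksProject, Tag 0BEC] -/
def prodSystem : Finset ι ⥤ Finset κ ⥤ ModuleCat.{u} A :=
  M ⋙ curriedTensor (ModuleCat.{u} A) ⋙ (Functor.whiskeringLeft _ _ _).obj N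

omit [LinearOrder ι] [LinearOrder κ] in
/-- `(M ⊠ N) s t = M s ⊗ N t` (`rfl`). [cite: StacksProject, Tag 0BEC] -/
@[simp] theorem prodSystem_obj_obj (s : Finset ι) (t : Finset κ) :
    ((prodSystem M N).obj s).obj t = (M.obj s ⊗ N.obj t) := rfl

omit [LinearOrder ι] [LinearOrder κ] in
/-- Restriction in `t` is `M s ◁ N.map` (`rfl`). [cite: StacksProject, Tag 0BEC] -/
theorem prodSystem_obj_map (s : Finset ι) {t t' : Finset κ} (h : t ⟶ t') :
    ((prodSystem M N).obj s).map h = M.obj s ◁ N.map h := rfl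

omit [LinearOrder ι] [LinearOrder κ] in
/-- Restriction in `s` is `M.map ▷ N t` (`rfl`). [cite: StacksProject, Tag 0BEC] -/
theorem prodSystem_map_app {s s' : Finset ι} (h : s ⟶ s') (t : Finset κ) :
    ((prodSystem M N).map h).app t = M.map h ▷ N.obj t := rfl

end Tensor

end OrderedCech

end Literature.Algebra.Homology

end
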